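import Summits.BirchSwinnertonDyer.BirchSwinnertonDyer.Theses.SignedLowerHalves
import Summits.BirchSwinnertonDyer.Rank1Residual.GaloisImage.NonsplitCartanDictionary
import Literature.NumberTheory.EllipticCurves.Rank1Residual.Typed.X7
import HarnessLib

/-!
# Route `SignedLowerHalves`, crux `KobayashiMainConjectureSmallImage` (item stmt-BirchSwinnertonDyer-19002):
# the crux's domain IS the `X_ns⁺(p)` locus; it is EMPTY at `p = 13, 17` (Balakrishnan–Dogra–Müller–
# Tuitman–Vonk), and the crux REDUCES to its four primes `p ∈ {3, 5, 7, 11}` plus the Serre-uniformity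
# input «`X_ns⁺(p)(ℚ)` is CM» for `p ≥ 19` (cell `bsd-ssimc`, seat `bsd-ssimc-k3-c4` gen 0; helper file)

PARTITION (cell bsd-ssimc): X7 (A7) × the NON-surjective `a_p = 0` pairs at odd good supersingular
`p` — types-the-object-of (the class as a modular curve) and closes the SUB-CLASSES `p = 13`,
`p = 17` of the crux (vacuously: they are EMPTY for non-CM curves, by two PUBLISHED theorems consumed
by name); closes NONE of the ledger items. THEOREMS ONLY; nothing about any curve is asserted;
nothing booked.

## What this file records

All the structure comes from the b2b cell's kernel theorems (team n1011,
`Rank1Residual/GaloisImage/{SupersingularNonsplitCartanNormalizer, NonsplitCartanDictionary}.lean`: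
Serre 1972 Prop. 12 + Prop. 17 + §5.2 (iv) + Prop. 14 ⟹ at a good supersingular `p ≠ 2` with
`ρ̄_{E,p}` not onto, `kˣ ≤ Φ(ρ̄(Γ_ℚ)) ≤ N(kˣ)`, `⊄ kˣ`, for the inertia non-split Cartan `kˣ`, and the
dictionary to the Serre-uniformity dossier's predicate
`Literature.NumberTheory.SerreUniformity.HasNonsplitCartanModPImage`) and from the dossier's two
PUBLISHED named facts `BDMTV2019_nonsplitCartan_level13` (Ann. of Math. 189 (2019) Cor. 1.3:
`X_ns⁺(13)(ℚ)` is CM) and `BDMTV2023_nonsplitCartan_level17` (Compositio 159 (2023) Thm. 1.2: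
`X_ns⁺(17)(ℚ)` is CM). This file only READS them on the crux:

* `smallImage_hasNonsplitCartanModPImage` — on the crux's domain (odd `p`, `ClassX7 W p`, `ρ̄_{E,p}`
  not onto) `E` is a non-cuspidal `ℚ`-point of `X_ns⁺(p)` (`HasNonsplitCartanModPImage W p`);
* `smallImage_false_of_nonsplitCartanPointsAreCM` — hence IF every `ℚ`-point of `X_ns⁺(p)` is CM
  (`NonsplitCartanPointsAreCM p`: a theorem at `13`, `17`; OPEN for `p ≥ 19`, Balakrishnan ICM 2026
  Problem 6.1) the crux's domain at `p` is EMPTY (its curves are non-CM);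
* `kobayashiMainConjectureSmallImage_of_nonsplitCartanPointsAreCM` — so the crux's statement at such
  a `p` holds vacuously; `kobayashiMainConjectureSmallImage_thirteen` / `_seventeen` — at `p = 13`,
  `17` from the PUBLISHED facts by name: the first CLOSED sub-classes of item 4;
* `kobayashiMainConjectureSmallImage_of_le_eleven_of_nonsplitCartanPointsAreCM` — **the reduction
  of the crux BY NAME**: `Theses.SignedLowerHalves.KobayashiMainConjectureSmallImage` follows from
  (i) its own restriction to the primes `p ≤ 11` (i.e. `p ∈ {3, 5, 7, 11}`: `3Nn` at `a_3 = 0`,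
  and the genus-0/0/1 curves `X_ns⁺(5)`, `X_ns⁺(7)`, `X_ns⁺(11)`, each with infinitely many non-CM
  points), (ii) BDMTV 2019 / 2023 (published, binders `h13`, `h17`), and (iii)
  `NonsplitCartanPointsAreCM p` for every prime `p ≥ 19` — the non-split-Cartan half of Serre's
  uniformity question (OPEN; expected TRUE). So, modulo Serre uniformity, item 4 is a statement
  about FOUR primes.

What is NOT here: any claim at `p ∈ {3, 5, 7, 11}` (there the crux is Kobayashi's conjecture on an
infinite non-CM family with no engine in print — files `…SmallImageNoEngine.lean`,
`…SmallImageSaturationRankZero.lean`); `NonsplitCartanPointsAreCM p` for any `p ≥ 19` (a hypothesis);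
anything booked.

References: [Serre1972] §1.11 Prop. 12, §2.2 Prop. 14, §2.7 Prop. 17, §5.2 (iv);
[BalakrishnanEtAl2019] Cor. 1.3; [BalakrishnanEtAl2023] Thm. 1.2; [SerreKyoto1977] 6.5–6.6;
[Balakrishnan2026ICM] Problem 6.1; [Kobayashi2003] Conjecture (p. 2).
-/

set_option autoImplicit false
set_option linter.dupNamespace false

noncomputable section

open scoped Classical

open WeierstrassCurve Literature.NumberTheory.EllipticCurves
  Literature.NumberTheory.EllipticCurves.Rank1Residual Literature.NumberTheory.SerreUniformity
  Summit.BirchSwinnertonDyer.Rank1Residual.Supersingular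
  Summit.BirchSwinnertonDyer.Rank1Residual.GaloisImage

namespace Summit.BirchSwinnertonDyer.BirchSwinnertonDyer.Theorems

variable (W : WeierstrassCurve ℚ) [W.IsElliptic] [W.IsGloballyMinimal] (p : ℕ) [Fact p.Prime]

/-- **The crux's domain is the `X_ns⁺(p)` locus.** On an X7 pair at an odd prime with `ρ̄_{E,p}` not
onto, the mod-`p` image lies in the normaliser of a non-split Cartan subgroup:
`HasNonsplitCartanModPImage W p` (in some basis of `E[p]` every `σ ∈ Γ_ℚ` acts through
`(a, εb; b, ±a)`, `ε` a non-square) — `E` is a non-cuspidal `ℚ`-point of `X_ns⁺(p)`. Reading of the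
b2b cell's `hasNonsplitCartanModPImage_of_goodSS_of_not_surj` (Serre Prop. 12 / 17 / 14 / §5.2 (iv)).
[cite: Serre1972, §1.11 Prop. 12, §2.2 Prop. 14, §2.7 Prop. 17, §5.2 (iv)] -/
theorem smallImage_hasNonsplitCartanModPImage (hp : p ≠ 2) (hX : ClassX7 W p) (hs : ¬ Surj W p) :
    HasNonsplitCartanModPImage W p :=
  hasNonsplitCartanModPImage_of_goodSS_of_not_surj W p hp hX.1 hs

/-- **If every `ℚ`-point of `X_ns⁺(p)` is CM, the crux's domain at `p` is EMPTY**: an X7 pair at an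
odd `p` with `ρ̄_{E,p}` not onto and `E` non-CM cannot exist when `NonsplitCartanPointsAreCM p`
(a PUBLISHED theorem for `p = 13, 17`; OPEN for `p ≥ 19`; FALSE for `p ∈ {3, 5, 7, 11}`, where it is
not assumed). [cite: SerreKyoto1977, questions 6.5–6.6, pp. 187–188] -/
theorem smallImage_false_of_nonsplitCartanPointsAreCM (hU : NonsplitCartanPointsAreCM p) (hp : p ≠ 2)
    (hX : ClassX7 W p) (hcm : ¬ W.HasCM) (hs : ¬ Surj W p) : False :=
  hcm (hU W (smallImage_hasNonsplitCartanModPImage W p hp hX hs))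

/-- **The crux at a prime `p` with `X_ns⁺(p)(ℚ)` CM holds vacuously** (both signs, indeed anything):
`NonsplitCartanPointsAreCM p` ⟹ for every X7 pair at `p` (odd) with `¬CM`, `a_p = 0`, `ρ̄_{E,p}` not
onto, `∃ ε, KobayashiMainConjecture W p ε`. [cite: SerreKyoto1977, questions 6.5–6.6, pp. 187–188] -/
theorem kobayashiMainConjectureSmallImage_of_nonsplitCartanPointsAreCM
    (hU : NonsplitCartanPointsAreCM p) (hp : p ≠ 2) (hX : ClassX7 W p) (hcm : ¬ W.HasCM)
    (_hap : W.frobeniusTrace p = 0) (hs : ¬ Surj W p) :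
    ∃ ε : ℤˣ, KobayashiMainConjecture W p ε :=
  (smallImage_false_of_nonsplitCartanPointsAreCM W p hU hp hX hcm hs).elim

/-- **Item 4 at `p = 13`: CLOSED (vacuously) from the PUBLISHED theorem `X_ns⁺(13)(ℚ)` = CM points**
(Balakrishnan–Dogra–Müller–Tuitman–Vonk, Ann. of Math. 189 (2019), Cor. 1.3; tree named fact
`BDMTV2019_nonsplitCartan_level13`, binder `h13`): there is NO non-CM X7 pair with non-surjective
`ρ̄_{E,13}` (b2b: `surj_thirteen_of_goodSS_of_not_hasCM`), so the crux's clause at `13` holds.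
CONDITIONAL on the cite-only published fact; closes no ledger item. [cite: BalakrishnanEtAl2019, Cor. 1.3] -/
theorem kobayashiMainConjectureSmallImage_thirteen [Fact (Nat.Prime 13)]
    (h13 : BDMTV2019_nonsplitCartan_level13) (V : WeierstrassCurve ℚ) [V.IsElliptic]
    [V.IsGloballyMinimal] (hX : ClassX7 V 13) (hcm : ¬ V.HasCM) (hap : V.frobeniusTrace 13 = 0)
    (hs : ¬ Surj V 13) : ∃ ε : ℤˣ, KobayashiMainConjecture V 13 ε :=
  kobayashiMainConjectureSmallImage_of_nonsplitCartanPointsAreCM V 13 h13 (by norm_num) hX hcm hap hs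

/-- **Item 4 at `p = 17`: CLOSED (vacuously) from the PUBLISHED theorem `X_ns⁺(17)(ℚ)` = CM points**
(BDMTV, Compositio 159 (2023), Thm. 1.2; named fact `BDMTV2023_nonsplitCartan_level17`, binder `h17`).
CONDITIONAL on the cite-only published fact; closes no ledger item. [cite: BalakrishnanEtAl2023, Thm. 1.2] -/
theorem kobayashiMainConjectureSmallImage_seventeen [Fact (Nat.Prime 17)]
    (h17 : BDMTV2023_nonsplitCartan_level17) (V : WeierstrassCurve ℚ) [V.IsElliptic]
    [V.IsGloballyMinimal] (hX : ClassX7 V 17) (hcm : ¬ V.HasCM) (hap : V.frobeniusTrace 17 = 0)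
    (hs : ¬ Surj V 17) : ∃ ε : ℤˣ, KobayashiMainConjecture V 17 ε :=
  kobayashiMainConjectureSmallImage_of_nonsplitCartanPointsAreCM V 17 h17 (by norm_num) hX hcm hap hs

omit [W.IsElliptic] [W.IsGloballyMinimal] [Fact p.Prime] in
/-- An odd prime `p` with `12 ≤ p ≤ 18` is `13` or `17`. Bookkeeping. [folklore] -/
theorem smallImage_prime_eq_thirteen_or_seventeen {q : ℕ} (hq : q.Prime) (h12 : 12 ≤ q)
    (h18 : q ≤ 18) : q = 13 ∨ q = 17 := by
  interval_cases q <;> first | (left; rfl) | (right; rfl) | exact absurd hq (by decide)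

/-- **THE REDUCTION OF THE CRUX BY NAME.** `KobayashiMainConjectureSmallImage` (route
`SignedLowerHalves`, item stmt-BirchSwinnertonDyer-19002) FOLLOWS from:
(i) `h11` — its own restriction to the primes `p ≤ 11`, i.e. Kobayashi's signed main conjecture (one
sign) for the non-CM X7 pairs with non-surjective image at `p ∈ {3, 5, 7, 11}` (the `3Nn` locus with
`a_3 = 0` and the non-CM points of the genus `0, 0, 1` curves `X_ns⁺(5)`, `X_ns⁺(7)`, `X_ns⁺(11)` —
infinite families; OPEN, no engine in print);
(ii) `h13`, `h17` — `X_ns⁺(13)(ℚ)`, `X_ns⁺(17)(ℚ)` are CM (PUBLISHED: BDMTV 2019 Cor. 1.3, 2023 Thm. 1.2);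
(iii) `h19` — `X_ns⁺(p)(ℚ)` is CM for every prime `p ≥ 19`: the non-split-Cartan half of Serre's
uniformity question (OPEN; Balakrishnan, ICM 2026, Problem 6.1; level `19` announced, not in print).
Proof: an odd prime is `≤ 11`, or `13`/`17`, or `≥ 19`; in the last two cases the crux's domain is
empty (`smallImage_false_of_nonsplitCartanPointsAreCM`). So MODULO SERRE UNIFORMITY item 4 is a
statement about four primes. CONDITIONAL; closes nothing. [cite: BalakrishnanEtAl2019, Cor. 1.3]
[cite: BalakrishnanEtAl2023, Thm. 1.2] [cite: SerreKyoto1977, questions 6.5–6.6, pp. 187–188]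
[cite: Kobayashi2003, Conjecture (Main Conjecture) (p. 2)] -/
theorem kobayashiMainConjectureSmallImage_of_le_eleven_of_nonsplitCartanPointsAreCM
    (h13 : BDMTV2019_nonsplitCartan_level13) (h17 : BDMTV2023_nonsplitCartan_level17)
    (h19 : ∀ (q : ℕ), q.Prime → 19 ≤ q → NonsplitCartanPointsAreCM q)
    (h11 : ∀ (V : WeierstrassCurve ℚ) [V.IsElliptic] [V.IsGloballyMinimal] (q : ℕ) [Fact q.Prime],
      q ≤ 11 → q ≠ 2 → ClassX7 V q → ¬ V.HasCM → V.frobeniusTrace q = 0 → ¬ Surj V q →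
      ∃ ε : ℤˣ, Summit.BirchSwinnertonDyer.Rank1Residual.Supersingular.KobayashiMainConjecture V q ε) :
    Summit.BirchSwinnertonDyer.BirchSwinnertonDyer.Theses.SignedLowerHalves.KobayashiMainConjectureSmallImage := by
  intro V _ _ q hq hq2 hX hcm hap hs
  have hqP : q.Prime := hq.out
  by_cases h11q : q ≤ 11
  · exact h11 V q h11q hq2 hX hcm hap hs
  by_cases h19q : 19 ≤ q
  · exact kobayashiMainConjectureSmallImage_of_nonsplitCartanPointsAreCM V q (h19 q hqP h19q) hq2 hX
      hcm hap hs
  -- `12 ≤ q ≤ 18` and `q` prime: `q = 13` or `q = 17`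
  rcases smallImage_prime_eq_thirteen_or_seventeen hqP (by omega) (by omega) with rfl | rfl
  · exact kobayashiMainConjectureSmallImage_of_nonsplitCartanPointsAreCM V 13 h13 hq2 hX hcm hap hs
  · exact kobayashiMainConjectureSmallImage_of_nonsplitCartanPointsAreCM V 17 h17 hq2 hX hcm hap hs

/-- **The same reduction with Serre uniformity folded into ONE binder**: if `X_ns⁺(p)(ℚ)` is CM for
every prime `p ≥ 13` (`h13up` — TRUE at `13`, `17` by BDMTV; OPEN from `19` on), the crux is
equivalent to its `p ≤ 11` part (`h11`). [cite: SerreKyoto1977, questions 6.5–6.6, pp. 187–188]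
[cite: Kobayashi2003, Conjecture (Main Conjecture) (p. 2)] -/
theorem kobayashiMainConjectureSmallImage_of_le_eleven_of_uniformity
    (h13up : ∀ (q : ℕ), q.Prime → 13 ≤ q → NonsplitCartanPointsAreCM q)
    (h11 : ∀ (V : WeierstrassCurve ℚ) [V.IsElliptic] [V.IsGloballyMinimal] (q : ℕ) [Fact q.Prime],
      q ≤ 11 → q ≠ 2 → ClassX7 V q → ¬ V.HasCM → V.frobeniusTrace q = 0 → ¬ Surj V q →
      ∃ ε : ℤˣ, Summit.BirchSwinnertonDyer.Rank1Residual.Supersingular.KobayashiMainConjecture V q ε) :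
    Summit.BirchSwinnertonDyer.BirchSwinnertonDyer.Theses.SignedLowerHalves.KobayashiMainConjectureSmallImage := by
  intro V _ _ q hq hq2 hX hcm hap hs
  have hqP : q.Prime := hq.out
  by_cases h11q : q ≤ 11
  · exact h11 V q h11q hq2 hX hcm hap hs
  · have h13q : 13 ≤ q := by
      rcases Nat.lt_or_ge q 13 with hlt | hge
      · interval_cases q; exact absurd hqP (by decide)
      · exact hge
    exact kobayashiMainConjectureSmallImage_of_nonsplitCartanPointsAreCM V q (h13up q hqP h13q) hq2 hX
      hcm hap hs

end Summit.BirchSwinnertonDyer.BirchSwinnertonDyer.Theorems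

end
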